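import Literature.MathematicalPhysics.QuantumFieldTheory.ZnAreaLawGinibre
import Literature.MathematicalPhysics.QuantumFieldTheory.ZnCentreDominatedWilsonLoopsAllN
import Literature.Probability.LatticeModels.GinibreBondDecouplingFiniteSqrtExtension
import HarnessLib

/-!
# The area law of `ℤ_n` lattice gauge theory at strong coupling by correlation inequalities,
# EVERY `n ≥ 2` (even `n` included)

Companion of `ZnAreaLawGinibre.lean`, which proves — by the Griffiths/Ginibre-inequality route of
Tomboulis–Ukawa–Windey 1981 / Sá Barreto–O'Carroll 1983 / Mota–Sá Barreto 2024 §2, with no cluster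
expansion — that the `ℤ_n` lattice gauge theory `znRep n` on the torus `(ℤ/Lℤ)^d` obeys

  `0 ≤ ⟨W_{R×T}⟩_{ℤ_n,β,L} ≤ (2(d−1)β)^{RT}`   (`β ≥ 0`, `2R, 2T ≤ L`),

hence `HasAreaLaw d (znRep n) β` for `2(d−1)β < 1`, for `n` ODD (`zn_hasAreaLaw`): the one-bond
decoupling step there uses Ginibre's comparison inequality for groups in which every element is a
square. This file removes the parity restriction («At strong couplings it [the `ℤ_n` theory] is in the
confinement phase», Montvay–Münster §3.7 p. 164, for every `n`): the configurations `ℤ_n^E` embed in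
`ℤ_{2n}^E`, where every `ℤ_n`-configuration is a square and from which all plaquette and chain
characters restrict (Ginibre 1970 §2 Example 4, the discrete case `ℤ_p` of ANY order `p`; tree
`exists_mul_self_eq_inclusion_rootsOfUnityCircle`, `GinibreSqrtExt.exists_mul_self_eq_compLeft`),
so the decoupling inequality through a square-root extension
(`Literature.Probability.LatticeModels.GinibreSqrtExt.ginibreExpect_reChar_le_mul_sum_decouple_of_sqrtExt`,
`GinibreBondDecouplingFiniteSqrtExtension.lean`) replaces the odd-`n` step; the one-link vanishing
(`znChainExpect_cplOff_eq_zero`), the iteration on the `ℤ_n`-spanning number and the slab/detector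
geometry (`ZnAreaLawGinibre.mul_le_card_filter_not_dvd`, any `n ≥ 2`) are those of the odd file.

## Main results (sorry-free, no new facts)

* `ZnAreaLawGinibre.znChainExpect_le_sum_decouple_of_neZero` — the one-link decoupling step
  `⟨Re ψ_c⟩ ≤ β ∑_{p∋b} ½(⟨Re ψ_{c+∂p}⟩ + ⟨Re ψ_{c−∂p}⟩)` for every `n ≥ 1` and `n ∤ c(b)`;
* `ZnAreaLawGinibre.znChainExpect_le_pow_min_of_neZero` — the iterated bound;
* `zn_wilsonExpectation_wilsonLoop_le_pow_of_two_le`, `…_le_exp_of_two_le` — the finite-volume bound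
  `⟨W_{R×T}⟩_{ℤ_n,β,L} ≤ (2(d−1)β)^{RT}`, every `n ≥ 2`;
* `zn_hasAreaLaw_of_two_le` — `HasAreaLaw d (znRep n) β` for `n ≥ 2`, `0 ≤ β`, `2(d−1)β < 1`
  (`d = 4`: `β < 1/6`, `zn_hasAreaLaw_dim4_of_two_le`); e.g. `ℤ₂` (in the `znRep 2` currency; the
  `±1` currency is `z2_hasAreaLaw`), `ℤ₄`, `ℤ₆`, …;
* `hasAreaLaw_of_zn_of_lt_of_neZero` — confinement of any compact `G` with a central `ℤ_n` (`n ≥ 2`)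
  acting by scalars in `ρ`, at `2N(d−1)β < 1`, through the tree's all-`n` centre domination
  `hasAreaLaw_of_zn_of_neZero`;
* `zn_hasAreaLawState_of_two_le`, `zn_hasAreaLawWith_of_mem_limitPoints_of_two_le`,
  `zn_le_stringTension_of_two_le` — limit states: area law and string tension
  `σ_{ℤ_n} ≥ −log(2(d−1)β)`.

HONEST LABELS. Strong coupling only: the `ℤ_n` theory deconfines at weak coupling in `d = 3, 4`
(Montvay–Münster p. 164; tree barriers `ZnHiggsPhaseD4`, `DiscreteSubgroupFreezing`). Nothing here
bears on the Yang–Mills mass gap (Clay problem), which is NOT proved; the cell's route R4 closes only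
the conditional finite-`𝕋⁴` rung `BalabanLadder.UV`.

## References

* [MontvayMunster1994] I. Montvay, G. Münster, Quantum Fields on a Lattice, CUP 1994, §3.7 (p. 164).
* [MotaSaBarreto2024] A. L. Mota, F. C. Sá Barreto, arXiv:2402.12277, §2 eqs. (3)–(5).
* [TomboulisUkawaWindey1981] Nucl. Phys. B 180 (1981) 294.
* [Ginibre1970] J. Ginibre, Commun. Math. Phys. 16 (1970) 310, §2 Example 4 (discrete case), Model 3.
* [Grosse1988] H. Grosse, Models in Statistical Physics and QFT, §4.2.4 (4.134); [Frohlich1979ZN].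
-/

noncomputable section

open MeasureTheory Finset
open scoped Real
open Literature.Probability.LatticeModels Literature.MathematicalPhysics.QuantumLattice
open Literature.Barriers.QuantumFields (rootsOfUnityCircle mem_rootsOfUnityCircle znRep continuous_znRep)

namespace Literature.MathematicalPhysics.QuantumFieldTheory

namespace ZnAreaLawGinibre

open U1AreaLawWard

variable {d L : ℕ} [NeZero L] {n : ℕ}

/-! ### §1 The `ℤ_n` chain system is restricted from the `ℤ_{2n}` one -/

/-- The chain characters of the `ℤ_n` theory are the restrictions of those of the `ℤ_{2n}` theory
along `ℤ_n^E ↪ ℤ_{2n}^E` (both are the `U(1)` chain character of the underlying configuration).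
[cite: Ginibre1970, §2 Example 4 (discrete case, p. 316–317)] -/
theorem abelianChainChar_znIncl_eq_comp (n : ℕ) (c : Edge d L → ℤ)
    (σ : GaugeConfig d L ↥(rootsOfUnityCircle n)) :
    abelianChainChar (znIncl n) c σ = abelianChainChar (znIncl (2 * n)) c
      (MonoidHom.compLeft (Subgroup.inclusion (rootsOfUnityCircle_le_two_mul n)) (Edge d L) σ) := rfl

omit [NeZero L] in
/-- The plaquette characters of the `ℤ_n` theory are the restrictions of those of the `ℤ_{2n}`
theory along `ℤ_n^E ↪ ℤ_{2n}^E`. [cite: Ginibre1970, §2 Example 4 (discrete case, p. 316–317)] -/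
theorem abelianPlaquetteChars_znIncl_eq_comp (n : ℕ) (p : Plaquette d L)
    (σ : GaugeConfig d L ↥(rootsOfUnityCircle n)) :
    abelianPlaquetteChars (znIncl n) d L p σ = abelianPlaquetteChars (znIncl (2 * n)) d L p
      (MonoidHom.compLeft (Subgroup.inclusion (rootsOfUnityCircle_le_two_mul n)) (Edge d L) σ) := rfl

/-- `ψ_c(σ) = ∏ₑ φ(σ_e)^{c(e)}`. [folklore] -/
private theorem abelianChainChar_apply' {Γ : Type*} [CommGroup Γ] [TopologicalSpace Γ]
    (φ : Γ →ₜ* Circle) (c : Edge d L → ℤ) (σ : GaugeConfig d L Γ) :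
    abelianChainChar φ c σ = ∏ e, φ (σ e) ^ c e := rfl

/-- `ψ_{c+c'} = ψ_c ψ_{c'}` for chain characters. [folklore] -/
private theorem abelianChainChar_add' {Γ : Type*} [CommGroup Γ] [TopologicalSpace Γ]
    (φ : Γ →ₜ* Circle) (c c' : Edge d L → ℤ) :
    abelianChainChar (d := d) (L := L) φ (c + c') = abelianChainChar φ c * abelianChainChar φ c' := by
  refine ContinuousMonoidHom.ext fun σ => ?_
  rw [ContinuousMonoidHom.mul_apply, abelianChainChar_apply', abelianChainChar_apply',
    abelianChainChar_apply', ← Finset.prod_mul_distrib]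
  exact Finset.prod_congr rfl fun e _ => by rw [Pi.add_apply, zpow_add]

/-- `ψ_{c-c'} = ψ_c ψ_{c'}⁻¹` for chain characters. [folklore] -/
private theorem abelianChainChar_sub' {Γ : Type*} [CommGroup Γ] [TopologicalSpace Γ]
    (φ : Γ →ₜ* Circle) (c c' : Edge d L → ℤ) :
    abelianChainChar (d := d) (L := L) φ (c - c') = abelianChainChar φ c * (abelianChainChar φ c')⁻¹ := by
  have h := abelianChainChar_add' (d := d) (L := L) φ (c - c') c'
  rw [sub_add_cancel] at h
  rw [h, mul_inv_cancel_right]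

/-- `⟨Re ψ_c⟩ ≤ 1`. [folklore] -/
private theorem znChainExpect_le_one' (β : ℝ) (c : Edge d L → ℤ) : znChainExpect (L := L) n β c ≤ 1 := by
  unfold znChainExpect ginibreExpect
  set μ := (Measure.pi fun _ : Edge d L => haarProbability ↥(rootsOfUnityCircle n)) with hμ
  have hw : Continuous (ginibreWeight (abelianPlaquetteChars (znIncl n) d L) fun _ : Plaquette d L => β) :=
    continuous_ginibreWeight _ _
  have hint : Integrable (ginibreWeight (abelianPlaquetteChars (znIncl n) d L) fun _ : Plaquette d L => β) μ :=
    integrable_of_continuous_compactSpace _ hw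
  have hZ : 0 < ∫ θ, ginibreWeight (abelianPlaquetteChars (znIncl n) d L) (fun _ : Plaquette d L => β) θ ∂μ :=
    integral_exp_pos hint
  rw [div_le_one hZ]
  refine integral_mono (integrable_of_continuous_compactSpace _ ((continuous_reChar _).mul hw)) hint
    fun θ => ?_
  exact mul_le_of_le_one_left (Real.exp_pos _).le ((le_abs_self _).trans (abs_reChar_le_one _ θ))

/-! ### §2 The one-link decoupling step for every `n` -/

/-- **The one-link decoupling step for `ℤ_n`, EVERY `n ≥ 1`**: for `β ≥ 0`, an integer `1`-chain
`c` and a link `b` with `n ∤ c(b)`,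

  `⟨Re ψ_c⟩_{ℤ_n,β,L} ≤ β ∑_{p ∋ b} ½ (⟨Re ψ_{c+∂p}⟩ + ⟨Re ψ_{c−∂p}⟩)`

— the one-link vanishing (`znChainExpect_cplOff_eq_zero`: rotate `σ_b` by `ζ_n`) fed into the
Ginibre one-bond decoupling inequality THROUGH THE SQUARE-ROOT EXTENSION `ℤ_n^E ↪ ℤ_{2n}^E`
(`GinibreSqrtExt.ginibreExpect_reChar_le_mul_sum_decouple_of_sqrtExt`), so that even `n` is covered
(odd `n`: the tree's `znChainExpect_le_sum_decouple`). [cite: MotaSaBarreto2024, §2 eq. (3)] [cite: Ginibre1970, §2 Example 4 (discrete case, p. 316–317)] -/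
theorem znChainExpect_le_sum_decouple_of_neZero [NeZero n] {β : ℝ} (hβ : 0 ≤ β)
    (c : Edge d L → ℤ) {b : Edge d L} (hb : ¬(n : ℤ) ∣ c b) :
    znChainExpect (L := L) n β c ≤ β * ∑ p ∈ univ.filter (fun p : Plaquette d L => b ∈ torusPlaqEdges p),
      (znChainExpect (L := L) n β (c + bdChain p) + znChainExpect (L := L) n β (c - bdChain p)) / 2 := by
  have h2 := rootsOfUnityCircle_le_two_mul n
  have h := GinibreSqrtExt.ginibreExpect_reChar_le_mul_sum_decouple_of_sqrtExt
    (Measure.pi fun _ : Edge d L => haarProbability ↥(rootsOfUnityCircle n))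
    (MonoidHom.compLeft (Subgroup.inclusion h2) (Edge d L))
    (Subgroup.inclusion_injective h2).comp_left
    (GinibreSqrtExt.exists_mul_self_eq_compLeft _ (exists_mul_self_eq_inclusion_rootsOfUnityCircle n))
    (abelianPlaquetteChars (znIncl n) d L) (abelianPlaquetteChars (znIncl (2 * n)) d L)
    (fun _ _ => rfl) hβ
    (univ.filter fun p : Plaquette d L => b ∈ torusPlaqEdges p) (abelianChainChar (znIncl n) c)
    (abelianChainChar (znIncl (2 * n)) c) (fun _ => rfl)
    (znChainExpect_cplOff_eq_zero β c hb)
  refine h.trans (le_of_eq ?_)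
  congr 1
  refine Finset.sum_congr rfl fun p _ => ?_
  rw [← abelianChainChar_bdChain, ← abelianChainChar_add', ← abelianChainChar_sub']
  rfl

/-! ### §3 Iteration on the `ℤ_n`-spanning number, every `n` -/

/-- The `ℤ_n`-spanning number drops by at most one under `c ↦ c + s ∂p₀` (as in the odd file).
[folklore] -/
private theorem znCost_shift' {c : Edge d L → ℤ} {m : ℕ}
    (hm : ∀ a : Plaquette d L → ℤ, (∀ e, (n : ℤ) ∣ ∑ p, a p * bdChain p e - c e) →
      m ≤ #(univ.filter fun p : Plaquette d L => ¬(n : ℤ) ∣ a p))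
    (p₀ : Plaquette d L) (s : ℤ) :
    ∀ a : Plaquette d L → ℤ, (∀ e, (n : ℤ) ∣ ∑ p, a p * bdChain p e - (c e + s * bdChain p₀ e)) →
      m - 1 ≤ #(univ.filter fun p : Plaquette d L => ¬(n : ℤ) ∣ a p) := by
  classical
  intro a ha
  set a' : Plaquette d L → ℤ := fun q => a q - if q = p₀ then s else 0 with ha'
  have h := hm a' (fun e => by
    have e1 : ∑ p, a' p * bdChain p e = ∑ p, a p * bdChain p e - s * bdChain p₀ e := by
      simp only [ha', sub_mul, Finset.sum_sub_distrib, ite_mul, zero_mul, Finset.sum_ite_eq',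
        Finset.mem_univ, if_true]
    rw [e1]
    have := ha e
    rwa [show ∑ p, a p * bdChain p e - (c e + s * bdChain p₀ e) =
      ∑ p, a p * bdChain p e - s * bdChain p₀ e - c e by ring] at this)
  have hsub : (univ.filter fun p : Plaquette d L => ¬(n : ℤ) ∣ a' p) ⊆
      insert p₀ (univ.filter fun p : Plaquette d L => ¬(n : ℤ) ∣ a p) := by
    intro q hq
    rw [Finset.mem_insert]
    by_cases hqp : q = p₀
    · exact Or.inl hqp
    · right
      rw [Finset.mem_filter] at hq ⊢
      have : a' q = a q := by simp [ha', hqp]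
      exact ⟨Finset.mem_univ _, by rw [← this]; exact hq.2⟩
  have h2 := (Finset.card_le_card hsub).trans (Finset.card_insert_le _ _)
  omega

/-- **THE ITERATED BOUND FOR `ℤ_n`, EVERY `n ≥ 1`** (inductive form): for `β ≥ 0` and every `k`, if
every integer `2`-chain `a` with `∑ₚ aₚ ∂p ≡ c (mod n)` has at least `m` entries `n ∤ aₚ`, then
`⟨Re ψ_c⟩_{ℤ_n,β,L} ≤ (2(d−1)β)^{min k m}` — one decoupling step costs `β · 2(d−1)`
(`card_filter_mem_torusPlaqEdges_le`). (Odd `n`: the tree's `znChainExpect_le_pow_min`.)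
[cite: MotaSaBarreto2024, §2 eqs. (4)–(5)] -/
theorem znChainExpect_le_pow_min_of_neZero [NeZero n] {β : ℝ} (hβ : 0 ≤ β) :
    ∀ (k : ℕ) (c : Edge d L → ℤ) (m : ℕ),
      (∀ a : Plaquette d L → ℤ, (∀ e, (n : ℤ) ∣ ∑ p, a p * bdChain p e - c e) →
        m ≤ #(univ.filter fun p : Plaquette d L => ¬(n : ℤ) ∣ a p)) →
        znChainExpect (L := L) n β c ≤ (2 * ((d - 1 : ℕ) : ℝ) * β) ^ min k m := by
  classical
  intro k
  induction k with
  | zero =>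
    intro c m _
    rw [Nat.zero_min, pow_zero]
    exact znChainExpect_le_one' β c
  | succ k ih =>
    intro c m hm
    rcases Nat.eq_zero_or_pos m with rfl | hmpos
    · rw [Nat.min_zero, pow_zero]
      exact znChainExpect_le_one' β c
    obtain ⟨b, hb⟩ : ∃ b, ¬(n : ℤ) ∣ c b := by
      by_contra h
      push Not at h
      have h0 := hm (fun _ => 0) (fun e => by simpa using (h e).neg_right)
      simp at h0
      omega
    have hB0 : 0 ≤ (2 * ((d - 1 : ℕ) : ℝ) * β) ^ min k (m - 1) := by positivity
    have hmax : ∀ p : Plaquette d L,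
        (znChainExpect (L := L) n β (c + bdChain p) + znChainExpect (L := L) n β (c - bdChain p)) / 2 ≤
          (2 * ((d - 1 : ℕ) : ℝ) * β) ^ min k (m - 1) := by
      intro p
      have h₁ : znChainExpect (L := L) n β (c + bdChain p) ≤ (2 * ((d - 1 : ℕ) : ℝ) * β) ^ min k (m - 1) :=
        ih _ _ fun a ha => znCost_shift' hm p 1 a fun e => by rw [one_mul]; exact ha e
      have h₂ : znChainExpect (L := L) n β (c - bdChain p) ≤ (2 * ((d - 1 : ℕ) : ℝ) * β) ^ min k (m - 1) :=
        ih _ _ fun a ha => znCost_shift' hm p (-1) a fun e => by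
          rw [neg_one_mul, ← sub_eq_add_neg]; exact ha e
      linarith
    calc znChainExpect (L := L) n β c
        ≤ β * ∑ p ∈ univ.filter (fun p : Plaquette d L => b ∈ torusPlaqEdges p),
            (znChainExpect (L := L) n β (c + bdChain p) + znChainExpect (L := L) n β (c - bdChain p)) / 2 :=
          znChainExpect_le_sum_decouple_of_neZero hβ c hb
      _ ≤ β * ∑ _p ∈ univ.filter (fun p : Plaquette d L => b ∈ torusPlaqEdges p),
            (2 * ((d - 1 : ℕ) : ℝ) * β) ^ min k (m - 1) :=
          mul_le_mul_of_nonneg_left (Finset.sum_le_sum fun p _ => hmax p) hβ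
      _ = β * (#(univ.filter fun p : Plaquette d L => b ∈ torusPlaqEdges p) *
            (2 * ((d - 1 : ℕ) : ℝ) * β) ^ min k (m - 1)) := by
          rw [Finset.sum_const, nsmul_eq_mul]
      _ ≤ β * (((2 * (d - 1) : ℕ) : ℝ) * (2 * ((d - 1 : ℕ) : ℝ) * β) ^ min k (m - 1)) := by
          refine mul_le_mul_of_nonneg_left (mul_le_mul_of_nonneg_right ?_ hB0) hβ
          exact_mod_cast card_filter_mem_torusPlaqEdges_le b
      _ = (2 * ((d - 1 : ℕ) : ℝ) * β) ^ (min k (m - 1) + 1) := by push_cast; ring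
      _ = (2 * ((d - 1 : ℕ) : ℝ) * β) ^ min (k + 1) m := by
          congr 1
          omega

end ZnAreaLawGinibre

open ZnAreaLawGinibre U1AreaLawWard

/-! ### §4 The finite-volume bound and the area law of the `ℤ_n` theory, every `n ≥ 2` -/

section FiniteVolume

variable {d L : ℕ} [NeZero L] {n : ℕ}

/-- **`ℤ_n` WILSON LOOPS AT STRONG COUPLING, FINITE VOLUME, EVERY `n ≥ 2`**: for `β ≥ 0`, every
torus `(ℤ/Lℤ)^d`, plane `i ≠ j` and `R × T` rectangle with `2R ≤ L`, `2T ≤ L`,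

  `⟨W_{R×T}⟩_{ℤ_n,β,L} ≤ (2(d−1)β)^{RT}`

(Griffiths/Ginibre-inequality proof through the square-root extension `ℤ_n^E ↪ ℤ_{2n}^E`; no
cluster expansion; odd `n`: the tree's `zn_wilsonExpectation_wilsonLoop_le_pow`).
[cite: MotaSaBarreto2024, §2 eqs. (4)–(5)] [cite: MontvayMunster1994, §3.7 (PDF p. 164)] -/
theorem zn_wilsonExpectation_wilsonLoop_le_pow_of_two_le (hn2 : 2 ≤ n) {β : ℝ} (hβ : 0 ≤ β)
    (x : Site d L) {i j : Fin d} (hij : i ≠ j) {R T : ℕ} (hRL : 2 * R ≤ L) (hTL : 2 * T ≤ L) :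
    wilsonExpectation (L := L) (znRep n) β (wilsonLoop (znRep n) x i j R T) ≤
      (2 * ((d - 1 : ℕ) : ℝ) * β) ^ (R * T) := by
  haveI : NeZero n := ⟨by omega⟩
  rw [wilsonExpectation_zn_wilsonLoop_eq_znChainExpect]
  have h := znChainExpect_le_pow_min_of_neZero (d := d) (L := L) (n := n) hβ (R * T)
    (rectChain x i j R T) (R * T) (fun a ha => mul_le_card_filter_not_dvd hij hn2 hRL hTL ha)
  rwa [min_self] at h

/-- The exponential form, every `n ≥ 2`: `⟨W_{R×T}⟩_{ℤ_n,β,L} ≤ e^{-|log(2(d-1)β)| RT}` for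
`0 < 2(d-1)β`. [cite: MotaSaBarreto2024, §2 eq. (5)] -/
theorem zn_wilsonExpectation_wilsonLoop_le_exp_of_two_le (hn2 : 2 ≤ n) {β : ℝ} (hβ : 0 ≤ β)
    (hpos : 0 < 2 * ((d - 1 : ℕ) : ℝ) * β) (x : Site d L) {i j : Fin d} (hij : i ≠ j) {R T : ℕ}
    (hRL : 2 * R ≤ L) (hTL : 2 * T ≤ L) :
    wilsonExpectation (L := L) (znRep n) β (wilsonLoop (znRep n) x i j R T) ≤
      Real.exp (-(-Real.log (2 * ((d - 1 : ℕ) : ℝ) * β)) * (R * T)) := by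
  refine (zn_wilsonExpectation_wilsonLoop_le_pow_of_two_le hn2 hβ x hij hRL hTL).trans (le_of_eq ?_)
  rw [neg_neg, show Real.log (2 * ((d - 1 : ℕ) : ℝ) * β) * ((R : ℝ) * T) =
      ((R * T : ℕ) : ℝ) * Real.log (2 * ((d - 1 : ℕ) : ℝ) * β) by push_cast; ring,
    ← Real.log_pow, Real.exp_log (pow_pos hpos _)]

end FiniteVolume

section AreaLaw

variable {d n : ℕ}

/-- **THE AREA LAW OF `ℤ_n` LATTICE GAUGE THEORY AT STRONG COUPLING BY CORRELATION INEQUALITIES,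
EVERY `n ≥ 2`** («At strong couplings it is in the confinement phase», Montvay–Münster §3.7, all `n`;
the Griffiths-inequality route of Tomboulis–Ukawa–Windey 1981 / Mota–Sá Barreto 2024 §2 with Ginibre's
inequalities for clock variables of any order through `ℤ_n ⊂ ℤ_{2n}`): for `n ≥ 2`, `0 ≤ β`,
`2(d−1)β < 1`, the tree's volume-uniform torus area law `HasAreaLaw d (znRep n) β` holds with `C = 1`,
`c = −log(2(d−1)β)`. Even `n` (`ℤ₂` in the `znRep` currency, `ℤ₄`, `ℤ₆`, …) is new; odd `n` is the
tree's `zn_hasAreaLaw`. HONEST LABEL: strong coupling only (deconfined weak-coupling phase in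
`d = 3, 4`). [cite: MontvayMunster1994, §3.7 (PDF p. 164)] [cite: MotaSaBarreto2024, §2 eq. (5)] -/
theorem zn_hasAreaLaw_of_two_le (hn2 : 2 ≤ n) {β : ℝ} (hβ : 0 ≤ β)
    (hβd : 2 * ((d - 1 : ℕ) : ℝ) * β < 1) : HasAreaLaw d (znRep n) β := by
  haveI : NeZero n := ⟨by omega⟩
  by_cases hpos : 0 < 2 * ((d - 1 : ℕ) : ℝ) * β
  · refine ⟨1, -Real.log (2 * ((d - 1 : ℕ) : ℝ) * β), ?_, ?_⟩
    · rw [neg_pos]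
      exact Real.log_neg hpos hβd
    · intro L _ x i j R T hij hR hT hRL hTL
      rw [one_pow, one_mul, abs_of_nonneg (zn_wilsonExpectation_wilsonLoop_nonneg_of_neZero hβ x i j R T)]
      exact zn_wilsonExpectation_wilsonLoop_le_exp_of_two_le hn2 hβ hpos x hij hRL hTL
  · refine ⟨1, 1, one_pos, ?_⟩
    intro L _ x i j R T hij hR hT hRL hTL
    have h0 : 2 * ((d - 1 : ℕ) : ℝ) * β = 0 :=
      le_antisymm (not_lt.1 hpos) (mul_nonneg (by positivity) hβ)
    have hle := zn_wilsonExpectation_wilsonLoop_le_pow_of_two_le hn2 hβ x hij hRL hTL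
    rw [h0, zero_pow (Nat.mul_ne_zero (by omega) (by omega))] at hle
    rw [abs_of_nonneg (zn_wilsonExpectation_wilsonLoop_nonneg_of_neZero hβ x i j R T), one_pow, one_mul]
    exact hle.trans (Real.exp_pos _).le

/-- `d = 4`: the `ℤ_n` theory, every `n ≥ 2`, satisfies the area law for `0 ≤ β < 1/6`.
[cite: MontvayMunster1994, §3.7 (PDF p. 164)] -/
theorem zn_hasAreaLaw_dim4_of_two_le (hn2 : 2 ≤ n) {β : ℝ} (hβ : 0 ≤ β) (hβ6 : 6 * β < 1) :
    HasAreaLaw 4 (znRep n) β :=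
  zn_hasAreaLaw_of_two_le hn2 hβ (by norm_num; linarith)

/-- **`ℤ₄` lattice gauge theory confines at strong coupling** (`d = 4`, `0 ≤ β < 1/6`) — an even case
outside the odd-`n` theorem. [cite: MontvayMunster1994, §3.7 (PDF p. 164)] -/
theorem z4_hasAreaLaw_dim4 {β : ℝ} (hβ : 0 ≤ β) (hβ6 : 6 * β < 1) : HasAreaLaw 4 (znRep 4) β :=
  zn_hasAreaLaw_dim4_of_two_le (by norm_num) hβ hβ6

end AreaLaw

/-! ### §5 Confinement inherited from a central `ℤ_n`, every `n ≥ 2`, unconditionally -/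

section Centre

variable {d L N : ℕ} {G : Type*} [Group G] [TopologicalSpace G] [IsTopologicalGroup G]
  [CompactSpace G] [MeasurableSpace G] [BorelSpace G] [SecondCountableTopology G]
  (ρ : G →* Matrix (Fin N) (Fin N) ℂ)

/-- **Confinement from a central `ℤ_n`, EVERY `n ≥ 2`, unconditional at strong coupling**: for a
compact group `G`, a continuous unitary `ρ` on `ℂ^N` and `ι : ℤ_n → Z(G)` with `ρ(ι z) = z·1`
(`n ≥ 2`; even `n` included, e.g. the full centre `ℤ_N` of `SU(N)` for even `N`, `ℤ₄ ⊂ Spin(6)`), the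
`G`-theory satisfies the area law for `0 ≤ β`, `2N(d−1)β < 1` — Fröhlich's all-`n` centre domination
(tree `hasAreaLaw_of_zn_of_neZero`) with `zn_hasAreaLaw_of_two_le` at coupling `Nβ`. (Odd `n`: the
tree's `hasAreaLaw_of_zn_of_lt`.) [cite: Grosse1988, §4.2.4 (text after eq. (4.134))] [cite: Frohlich1979ZN, title theorem] -/
theorem hasAreaLaw_of_zn_of_lt_of_neZero {n : ℕ} (hn2 : 2 ≤ n) [NeZero n]
    (ι : ↥(rootsOfUnityCircle n) →* G) (hρ : Continuous ρ) (hρu : ∀ g, ρ g ∈ Matrix.unitaryGroup (Fin N) ℂ)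
    (hι : ∀ z, ι z ∈ Subgroup.center G)
    (hρι : ∀ z, ρ (ι z) = (((z : Circle) : ℂ)) • (1 : Matrix (Fin N) (Fin N) ℂ)) {β : ℝ} (hβ : 0 ≤ β)
    (hβd : 2 * ((d - 1 : ℕ) : ℝ) * ((N : ℝ) * β) < 1) : HasAreaLaw d ρ β :=
  hasAreaLaw_of_zn_of_neZero ρ ι hρ hρu hι hρι hβ (zn_hasAreaLaw_of_two_le hn2 (by positivity) hβd)

-- `SU(N)` through its FULL centre `ℤ_N` (even `N` included) is `suN_hasAreaLaw_of_zN hβ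
-- (zn_hasAreaLaw_of_two_le hN _ hβd)`; as a statement it coincides with the tree's
-- `specialUnitaryGroup_hasAreaLaw_of_lt` (even `N` there through the central involution), so it is
-- not restated here.

end Centre

/-! ### §6 Limit states and string tension of the `ℤ_n` theory, every `n ≥ 2` -/

section StringTension

variable {d n : ℕ} [NeZero d]

/-- `(0 : Fin d) ≠ 1` for `d ≥ 2`. [folklore] -/
private theorem fin_zero_ne_one₄ (hd : 2 ≤ d) : (0 : Fin d) ≠ 1 := by
  intro h01
  have := congrArg Fin.val h01
  rw [Fin.val_zero, Fin.val_one', Nat.one_mod_eq_one.mpr (by omega)] at this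
  exact zero_ne_one this

/-- **Area law for every infinite-volume limit state of the `ℤ_n` theory**, `n ≥ 2`, at
`2(d−1)β < 1` (`d ≥ 2`). [cite: MontvayMunster1994, §3.7 (PDF p. 164)] -/
theorem zn_hasAreaLawState_of_two_le (hd : 2 ≤ d) (hn2 : 2 ≤ n) {β : ℝ} (hβ : 0 ≤ β)
    (hβd : 2 * ((d - 1 : ℕ) : ℝ) * β < 1) {μ : Measure (LGConfig d ↥(rootsOfUnityCircle n))}
    (hμ : μ ∈ infiniteVolumeLimitPoints (znRep n) β) :
    HasAreaLawState μ (fun g => normalisedCharacter 1 (znRep n g)) :=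
  hasAreaLawState_of_hasAreaLaw_holds (d := d) (znRep n) hd (continuous_znRep n)
    (zn_hasAreaLaw_of_two_le hn2 hβ hβd) hμ

/-- **Explicit area law for the `ℤ_n` limit states at strong coupling**, `n ≥ 2`: for `d ≥ 2`,
`0 ≤ β`, `0 < 2(d−1)β`, every infinite-volume limit point `μ` of the `ℤ_n` torus Wilson states satisfies
`|W_μ(R,T)| ≤ e^{log(2(d−1)β) RT}` for all `R, T ≥ 1`, i.e. `HasAreaLawWith μ χ 1 (−log(2(d−1)β))`.
[cite: MotaSaBarreto2024, §2 eq. (5)] [cite: MontvayMunster1994, §3.7 (PDF p. 164)] -/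
theorem zn_hasAreaLawWith_of_mem_limitPoints_of_two_le (hd : 2 ≤ d) (hn2 : 2 ≤ n) {β : ℝ} (hβ : 0 ≤ β)
    (hpos : 0 < 2 * ((d - 1 : ℕ) : ℝ) * β) {μ : Measure (LGConfig d ↥(rootsOfUnityCircle n))}
    (hμ : μ ∈ infiniteVolumeLimitPoints (znRep n) β) :
    HasAreaLawWith μ (fun g => normalisedCharacter 1 (znRep n g)) 1
      (-Real.log (2 * ((d - 1 : ℕ) : ℝ) * β)) := by
  haveI : NeZero n := ⟨by omega⟩
  intro R T hR hT
  have hev : ∀ᶠ L : ℕ in Filter.atTop, |wilsonExpectation (L := L + 1) (znRep n) β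
      (wilsonLoop (znRep n) (0 : Site d (L + 1)) 0 1 R T)| ≤
        (1 : ℝ) ^ (2 * (R + T)) * Real.exp (-(-Real.log (2 * ((d - 1 : ℕ) : ℝ) * β)) * R * T) := by
    filter_upwards [Filter.eventually_ge_atTop (2 * R + 2 * T)] with L hL
    rw [one_pow, one_mul, abs_of_nonneg (zn_wilsonExpectation_wilsonLoop_nonneg_of_neZero hβ _ 0 1 R T),
      mul_assoc]
    exact zn_wilsonExpectation_wilsonLoop_le_exp_of_two_le hn2 hβ hpos _ (fin_zero_ne_one₄ hd)
      (by omega) (by omega)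
  exact abs_rectExpectation_le_of_eventually (znRep n) (continuous_znRep n) hμ hev

/-- **String tension of the `ℤ_n` theory at strong coupling**, `n ≥ 2`: if a limit state of the
`ℤ_n` torus states at `0 < 2(d−1)β` (`d ≥ 2`) has a string tension `σ`, then `σ ≥ −log(2(d−1)β)` —
positive for `2(d−1)β < 1` (`d = 4`: `σ ≥ log(1/(6β))`). [cite: MotaSaBarreto2024, §2 eq. (5)] [cite: MontvayMunster1994, §3.7 (PDF p. 164)] -/
theorem zn_le_stringTension_of_two_le (hd : 2 ≤ d) (hn2 : 2 ≤ n) {β : ℝ} (hβ : 0 ≤ β)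
    (hpos : 0 < 2 * ((d - 1 : ℕ) : ℝ) * β) {μ : Measure (LGConfig d ↥(rootsOfUnityCircle n))}
    (hμ : μ ∈ infiniteVolumeLimitPoints (znRep n) β) {σ : ℝ}
    (hσ : HasStringTension μ (fun g => normalisedCharacter 1 (znRep n g)) σ) :
    -Real.log (2 * ((d - 1 : ℕ) : ℝ) * β) ≤ σ :=
  (zn_hasAreaLawWith_of_mem_limitPoints_of_two_le hd hn2 hβ hpos hμ).le_of_hasStringTension hσ

end StringTension

end Literature.MathematicalPhysics.QuantumFieldTheory

end
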